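import Summits.BirchSwinnertonDyer.BirchSwinnertonDyer.Theorems.AdditiveKolyvaginRoadRamifiedHabitatSignLawEvenField
import Summits.BirchSwinnertonDyer.BirchSwinnertonDyer.Theorems.AdditiveKolyvaginRoadRamifiedHabitatSignLawPotMultAnyLevel
import Summits.BirchSwinnertonDyer.BirchSwinnertonDyer.Theorems.AdditiveKolyvaginRoadRamifiedHabitatSignLawInert
import HarnessLib

/-!
# Route `AdditiveKolyvaginRoad`, crux KS′ `LevelKolyvaginSystemsAdditive` (stmt-BirchSwinnertonDyer-21396), card `ramified-toric-habitat` —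
# the EVEN-habitat-discriminant sign law at ANY LEVEL (arbitrary cofactor `M = N/p²`): starred types, I₀*, pot-mult, field forms

Cell `pub/bsd-wall`, width seat `bsd-wall-akr-p2x-w3` g13; `--supports stmt-BirchSwinnertonDyer-21396` (helper). THEOREMS ONLY; no definition,
no named fact, no `sorry`. BSD is not proved by any of this; KS′/KPA′ stay OPEN at `p² ∣ N`.

This seat's `…SignLawEven*` files give the even-cofactor law `w(E)·w(E^{(p*·D')}) = −(−1/p)·(D'/p)^k·r` from ANY `p*`-level datum
`N_{E'} = M p^k`, `w(E)w(E') = (M/p)·r` (`…_of_four_dvd_of_pStar`, no hypothesis on `M` beyond `p ∤ M`), and used w2 g11's `p*`-level theorems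
(`M` squarefree) for the starred types, I₀* and the pot-mult row. w2 g12 has since landed the `p*`-level theorems for an ARBITRARY cofactor
(`…pStarTwist_of_localData_anyLevel`, `…pStarTwist_of_six_anyLevel`, `…pStarTwist_of_potMult_anyLevel`; Atkin–Li / Shemanske–Walling at the
primes `q ≠ p`). Plugging them in:

* §1 `rootNumber_mul_rootNumber_ramifiedTwist_even_of_mem_anyLevel` — all six potentially good non-I₀* types `a ∈ {2,3,4,8,9,10}` at ANY level:
  `w(E)·w(E^{(d)}) = −(−1/p)·W_p(E)W_p(E')`, and the dichotomy `…_eq_one_of_not_dvd` (`e ∤ p − 1 ⟹ +1`) / `…_eq_neg_one_of_dvd`.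
* §2 `rootNumber_mul_rootNumber_ramifiedTwist_even_of_six_anyLevel` (I₀*: `−1`, mod `hmod` only) and
  `rootNumber_mul_rootNumber_ramifiedTwist_even_of_potMult_anyLevel` (pot-mult: `−(D'/p)·W_p(E')`, mod `hmod` only), ANY level.
* §3 field forms (`K′` imaginary quadratic, `4 ∣ d_{K′}`, `p ∣ d_{K′}`, every prime of `M` split), ANY level:
  `rootNumber_mul_rootNumber_twist_discr_even_anyLevel_eq_one_of_not_dvd` / `…_eq_neg_one_of_dvd` / `…_of_six_anyLevel`.

Conditional on `exists_isNewformOf` and (§1, §3 non-I₀*) Kellock–Dokchitser's Rem. 2.2 at `p` for `E`, `E^{(p*)}`.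

References: [cite: MurtyMurty1997, Ch. 6 §1] [cite: Rohrlich1993Compositio, Prop. 2(iv)] [cite: KellockDokchitser2023, Rem. 2.2]
[cite: ShemanskeWalling1993, Prop. 5.4].
-/

set_option autoImplicit false
set_option linter.dupNamespace false

noncomputable section

open scoped Classical MatrixGroups NumberTheorySymbols

open CongruenceSubgroup IsDedekindDomain IsDedekindDomain.HeightOneSpectrum NumberField Rat.HeightOneSpectrum
  WeierstrassCurve Literature.NumberTheory.EllipticCurves Literature.NumberTheory.EllipticCurves.ModularForms
  IsDiscreteValuationRing

namespace Summit.BirchSwinnertonDyer.BirchSwinnertonDyer.Theorems.AdditiveKoly.RamifiedHabitat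

/-! ## §1 The six potentially good non-I₀* types, even habitat discriminant, any level -/

section EvenAnyLevel

variable {p : ℕ} [Fact p.Prime]

/-- **EVEN HABITAT DISCRIMINANT, ANY LEVEL, TYPES II/III/IV/IV*/III*/II*: `w(E)·w(E^{(d)}) = −(−1/p)·W_p(E)W_p(E^{(p*)})`.** `W/ℚ` elliptic of
conductor `N = M·p²` (`p ≥ 5`, `p ∤ M`, `M` ARBITRARY), minimal model at `p` additive potentially good with `ord_p Δ = a ∈ {2,3,4,8,9,10}`;
`d = p*·D'` with `D' = 4m` an even fundamental discriminant prime to `N`, `d < 0`, every prime of `M` split in `ℚ(√d)`. Then, modulo the Modularity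
Theorem and Kellock–Dokchitser's Rem. 2.2 at `p` for `W`, `W^{(p*)}`: `w(W)·w(W^{(d)}) = −(−1/p)·r`, `r = 1` if `e = 4` (`a ≡ 3 (6)`), `= (−1/p)(−3/p)`
otherwise. [cite: MurtyMurty1997, Ch. 6 §1] [cite: Rohrlich1993Compositio, Prop. 2(iv)] [cite: KellockDokchitser2023, Rem. 2.2] [cite: ShemanskeWalling1993, Prop. 5.4] -/
theorem rootNumber_mul_rootNumber_ramifiedTwist_even_of_mem_anyLevel (W : WeierstrassCurve ℚ) [W.IsElliptic] (hmod : exists_isNewformOf)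
    (hF1 : W.atkinLehnerEigenvalueAt_eq_localRootNumberAt)
    (hF1' : (W.quadraticTwist (((-1 : ℤ) ^ (p / 2) * p : ℤ) : ℚ)).atkinLehnerEigenvalueAt_eq_localRootNumberAt)
    (hp5 : 5 ≤ p) {M : ℕ} (hN : W.conductorNorm ℤ = M * p ^ 2) (hpM : ¬ p ∣ M) {a : ℕ}
    (hΔ : addVal ℤ_[p] (((W.baseChange ℚ_[p]).minimal ℤ_[p]).integralModel ℤ_[p]).Δ = a)
    (ha : a = 2 ∨ a = 3 ∨ a = 4 ∨ a = 8 ∨ a = 9 ∨ a = 10)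
    (hc₄ : addVal ℤ_[p] (((W.baseChange ℚ_[p]).minimal ℤ_[p]).integralModel ℤ_[p]).c₄ ≠ 0)
    (hj : ¬ 3 * addVal ℤ_[p] (((W.baseChange ℚ_[p]).minimal ℤ_[p]).integralModel ℤ_[p]).c₄ <
      addVal ℤ_[p] (((W.baseChange ℚ_[p]).minimal ℤ_[p]).integralModel ℤ_[p]).Δ)
    {D' : ℤ} (h4 : 4 ∣ D') (hm4 : D' / 4 % 4 = 2 ∨ D' / 4 % 4 = 3) (hsq : Squarefree (D' / 4))
    (hgcd : Int.gcd D' (W.conductorNorm ℤ) = 1) (hneg : (-1 : ℤ) ^ (p / 2) * p * D' < 0)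
    (hsplit : ∀ q ∈ M.primeFactors, q ≠ 2 → J((-1 : ℤ) ^ (p / 2) * p * D' | q) = 1) :
    W.rootNumber * (W.quadraticTwist (((-1 : ℤ) ^ (p / 2) * p * D' : ℤ) : ℚ)).rootNumber =
      -ZMod.χ₄ p * (if a % 6 = 3 then 1 else ZMod.χ₄ p * (if p % 3 = 1 then 1 else -1)) := by
  have hp : p.Prime := Fact.out
  have hp2 : p ≠ 2 := by omega
  have hdZ0 : ((-1 : ℤ) ^ (p / 2) * p : ℤ) ≠ 0 :=
    mul_ne_zero (pow_ne_zero _ (by norm_num)) (by exact_mod_cast hp.ne_zero)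
  have hd0 : (((((-1 : ℤ) ^ (p / 2) * p : ℤ)) : ℚ)) ≠ 0 := by exact_mod_cast hdZ0
  haveI hE' : (W.quadraticTwist (((-1 : ℤ) ^ (p / 2) * p : ℤ) : ℚ)).IsElliptic := W.isElliptic_quadraticTwist hd0
  obtain ⟨hadd, hadd', hprod⟩ := localRootNumber_mul_pStarTwist_padic_of_mem W hp5 hΔ ha hc₄ hj
  have hA := rootNumber_mul_rootNumber_pStarTwist_of_localData_anyLevel W hmod hF1 hF1' hp5 hN hpM hadd hadd' hprod
  have hN' : (W.quadraticTwist (((-1 : ℤ) ^ (p / 2) * p : ℤ) : ℚ)).conductorNorm ℤ = M * p ^ 2 :=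
    (conductorNorm_pStarTwist_eq W hp5 hadd hadd').trans hN
  have hgcd' : Int.gcd D' (M * p ^ 2 : ℕ) = 1 := by rw [← hN]; exact hgcd
  rw [rootNumber_mul_rootNumber_ramifiedTwist_of_four_dvd_of_pStar W hmod hp2 hpM hN' hA h4 hm4 hsq hgcd' hneg hsplit,
    jacobiSym_cofactor_prime_sq_eq_one hgcd', mul_one]

/-- **SUPERCUSPIDAL HALF, even habitat discriminant, ANY LEVEL, all six types** (`e := 12/gcd(12,a) ∤ p − 1 ⟹ +1`).
Conditional on {hmod, F1 at `p`}. [cite: Rohrlich1993Compositio, Prop. 2(iv)] [cite: KellockDokchitser2023, Rem. 2.2] -/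
theorem rootNumber_mul_rootNumber_ramifiedTwist_even_of_mem_anyLevel_eq_one_of_not_dvd (W : WeierstrassCurve ℚ) [W.IsElliptic]
    (hmod : exists_isNewformOf) (hF1 : W.atkinLehnerEigenvalueAt_eq_localRootNumberAt)
    (hF1' : (W.quadraticTwist (((-1 : ℤ) ^ (p / 2) * p : ℤ) : ℚ)).atkinLehnerEigenvalueAt_eq_localRootNumberAt)
    (hp5 : 5 ≤ p) {M : ℕ} (hN : W.conductorNorm ℤ = M * p ^ 2) (hpM : ¬ p ∣ M) {a : ℕ}
    (hΔ : addVal ℤ_[p] (((W.baseChange ℚ_[p]).minimal ℤ_[p]).integralModel ℤ_[p]).Δ = a)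
    (ha : a = 2 ∨ a = 3 ∨ a = 4 ∨ a = 8 ∨ a = 9 ∨ a = 10)
    (hc₄ : addVal ℤ_[p] (((W.baseChange ℚ_[p]).minimal ℤ_[p]).integralModel ℤ_[p]).c₄ ≠ 0)
    (hj : ¬ 3 * addVal ℤ_[p] (((W.baseChange ℚ_[p]).minimal ℤ_[p]).integralModel ℤ_[p]).c₄ <
      addVal ℤ_[p] (((W.baseChange ℚ_[p]).minimal ℤ_[p]).integralModel ℤ_[p]).Δ)
    {D' : ℤ} (h4 : 4 ∣ D') (hm4 : D' / 4 % 4 = 2 ∨ D' / 4 % 4 = 3) (hsq : Squarefree (D' / 4))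
    (hgcd : Int.gcd D' (W.conductorNorm ℤ) = 1) (hneg : (-1 : ℤ) ^ (p / 2) * p * D' < 0)
    (hsplit : ∀ q ∈ M.primeFactors, q ≠ 2 → J((-1 : ℤ) ^ (p / 2) * p * D' | q) = 1)
    (hsc : ¬ 12 / Nat.gcd a 12 ∣ p - 1) :
    W.rootNumber * (W.quadraticTwist (((-1 : ℤ) ^ (p / 2) * p * D' : ℤ) : ℚ)).rootNumber = 1 := by
  have hp2 : p ≠ 2 := by omega
  rw [rootNumber_mul_rootNumber_ramifiedTwist_even_of_mem_anyLevel W hmod hF1 hF1' hp5 hN hpM hΔ ha hc₄ hj h4 hm4 hsq hgcd hneg hsplit]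
  have hp' := (Nat.Prime.eq_two_or_odd (Fact.out : p.Prime)).resolve_left hp2
  have hχ₄ := χ₄_natCast_mul_self hp2
  by_cases h6 : a % 6 = 3
  · have e4 : 12 / Nat.gcd a 12 = 4 := by
      rcases ha with rfl | rfl | rfl | rfl | rfl | rfl <;> simp_all
    rw [e4] at hsc
    have h4' : p % 4 = 3 := by omega
    rw [if_pos h6, mul_one, ZMod.χ₄_nat_three_mod_four h4']
    norm_num
  · have h3 : p % 3 ≠ 1 := by
      intro h3
      rcases ha with rfl | rfl | rfl | rfl | rfl | rfl <;> simp_all <;> omega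
    rw [if_neg h6, if_neg h3, ← mul_assoc, neg_mul, hχ₄]
    norm_num

/-- **PRINCIPAL-SERIES HALF, even habitat discriminant, ANY LEVEL, all six types** (`e ∣ p − 1 ⟹ −1`; potentially good).
Conditional on {hmod, F1 at `p`}. [cite: Rohrlich1993Compositio, Prop. 2(iv)] [cite: KellockDokchitser2023, Rem. 2.2] -/
theorem rootNumber_mul_rootNumber_ramifiedTwist_even_of_mem_anyLevel_eq_neg_one_of_dvd (W : WeierstrassCurve ℚ) [W.IsElliptic]
    (hmod : exists_isNewformOf) (hF1 : W.atkinLehnerEigenvalueAt_eq_localRootNumberAt)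
    (hF1' : (W.quadraticTwist (((-1 : ℤ) ^ (p / 2) * p : ℤ) : ℚ)).atkinLehnerEigenvalueAt_eq_localRootNumberAt)
    (hp5 : 5 ≤ p) {M : ℕ} (hN : W.conductorNorm ℤ = M * p ^ 2) (hpM : ¬ p ∣ M) {a : ℕ}
    (hΔ : addVal ℤ_[p] (((W.baseChange ℚ_[p]).minimal ℤ_[p]).integralModel ℤ_[p]).Δ = a)
    (ha : a = 2 ∨ a = 3 ∨ a = 4 ∨ a = 8 ∨ a = 9 ∨ a = 10)
    (hc₄ : addVal ℤ_[p] (((W.baseChange ℚ_[p]).minimal ℤ_[p]).integralModel ℤ_[p]).c₄ ≠ 0)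
    (hj : ¬ 3 * addVal ℤ_[p] (((W.baseChange ℚ_[p]).minimal ℤ_[p]).integralModel ℤ_[p]).c₄ <
      addVal ℤ_[p] (((W.baseChange ℚ_[p]).minimal ℤ_[p]).integralModel ℤ_[p]).Δ)
    {D' : ℤ} (h4 : 4 ∣ D') (hm4 : D' / 4 % 4 = 2 ∨ D' / 4 % 4 = 3) (hsq : Squarefree (D' / 4))
    (hgcd : Int.gcd D' (W.conductorNorm ℤ) = 1) (hneg : (-1 : ℤ) ^ (p / 2) * p * D' < 0)
    (hsplit : ∀ q ∈ M.primeFactors, q ≠ 2 → J((-1 : ℤ) ^ (p / 2) * p * D' | q) = 1)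
    (hps : 12 / Nat.gcd a 12 ∣ p - 1) :
    W.rootNumber * (W.quadraticTwist (((-1 : ℤ) ^ (p / 2) * p * D' : ℤ) : ℚ)).rootNumber = -1 := by
  have hp2 : p ≠ 2 := by omega
  rw [rootNumber_mul_rootNumber_ramifiedTwist_even_of_mem_anyLevel W hmod hF1 hF1' hp5 hN hpM hΔ ha hc₄ hj h4 hm4 hsq hgcd hneg hsplit]
  have hp' := (Nat.Prime.eq_two_or_odd (Fact.out : p.Prime)).resolve_left hp2
  have hχ₄ := χ₄_natCast_mul_self hp2
  by_cases h6 : a % 6 = 3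
  · have e4 : 12 / Nat.gcd a 12 = 4 := by
      rcases ha with rfl | rfl | rfl | rfl | rfl | rfl <;> simp_all
    rw [e4] at hps
    have h4' : p % 4 = 1 := by omega
    rw [if_pos h6, mul_one, ZMod.χ₄_nat_one_mod_four h4']
  · have h3 : p % 3 = 1 := by
      rcases ha with rfl | rfl | rfl | rfl | rfl | rfl <;> simp_all <;> omega
    rw [if_neg h6, if_pos h3, ← mul_assoc, neg_mul, hχ₄, mul_one]

/-! ## §2 Type I₀* and the pot-mult row, even habitat discriminant, any level -/

/-- **TYPE I₀*, even habitat discriminant, ANY LEVEL: `w(E)·w(E^{(d)}) = −1`**, unconditional modulo the Modularity Theorem (`ord_p Δ_min = 6`;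
`E^{(p*)}` good at `p`, `N_{E'} = M`, the `k = 0` case). [cite: MurtyMurty1997, Ch. 6 §1] [cite: Rohrlich1993Compositio, Prop. 2(iv)] -/
theorem rootNumber_mul_rootNumber_ramifiedTwist_even_of_six_anyLevel (W : WeierstrassCurve ℚ) [W.IsElliptic] (hmod : exists_isNewformOf)
    (hp5 : 5 ≤ p) {M : ℕ} (hN : W.conductorNorm ℤ = M * p ^ 2) (hpM : ¬ p ∣ M)
    (hΔ : addVal ℤ_[p] (((W.baseChange ℚ_[p]).minimal ℤ_[p]).integralModel ℤ_[p]).Δ = (6 : ℕ))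
    (hc₄ : addVal ℤ_[p] (((W.baseChange ℚ_[p]).minimal ℤ_[p]).integralModel ℤ_[p]).c₄ ≠ 0)
    (hj : ¬ 3 * addVal ℤ_[p] (((W.baseChange ℚ_[p]).minimal ℤ_[p]).integralModel ℤ_[p]).c₄ <
      addVal ℤ_[p] (((W.baseChange ℚ_[p]).minimal ℤ_[p]).integralModel ℤ_[p]).Δ)
    {D' : ℤ} (h4 : 4 ∣ D') (hm4 : D' / 4 % 4 = 2 ∨ D' / 4 % 4 = 3) (hsq : Squarefree (D' / 4))
    (hgcd : Int.gcd D' (W.conductorNorm ℤ) = 1) (hneg : (-1 : ℤ) ^ (p / 2) * p * D' < 0)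
    (hsplit : ∀ q ∈ M.primeFactors, q ≠ 2 → J((-1 : ℤ) ^ (p / 2) * p * D' | q) = 1) :
    W.rootNumber * (W.quadraticTwist (((-1 : ℤ) ^ (p / 2) * p * D' : ℤ) : ℚ)).rootNumber = -1 := by
  have hp : p.Prime := Fact.out
  have hp2 : p ≠ 2 := by omega
  have hdZ0 : ((-1 : ℤ) ^ (p / 2) * p : ℤ) ≠ 0 :=
    mul_ne_zero (pow_ne_zero _ (by norm_num)) (by exact_mod_cast hp.ne_zero)
  have hd0 : (((((-1 : ℤ) ^ (p / 2) * p : ℤ)) : ℚ)) ≠ 0 := by exact_mod_cast hdZ0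
  haveI hE' : (W.quadraticTwist (((-1 : ℤ) ^ (p / 2) * p : ℤ) : ℚ)).IsElliptic := W.isElliptic_quadraticTwist hd0
  have hA := rootNumber_mul_rootNumber_pStarTwist_of_six_anyLevel W hmod hp5 hN hpM hΔ hc₄ hj
  obtain ⟨-, hgood, -⟩ := hasGoodReduction_pStarTwist_padic_of_six W hp5 hΔ hc₄ hj
  have hN' : (W.quadraticTwist (((-1 : ℤ) ^ (p / 2) * p : ℤ) : ℚ)).conductorNorm ℤ = M * p ^ 0 := by
    rw [conductorNorm_pStarTwist_mul_sq_eq_of_good W hp5 hN hpM hgood, pow_zero, mul_one]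
  have hgcd' : Int.gcd D' (M * p ^ 0 : ℕ) = 1 := by
    rw [pow_zero, mul_one]
    have h1 := Int.isCoprime_iff_gcd_eq_one.mpr hgcd
    rw [hN] at h1
    push_cast at h1
    exact Int.isCoprime_iff_gcd_eq_one.mp h1.of_mul_right_left
  rw [rootNumber_mul_rootNumber_ramifiedTwist_of_four_dvd_of_pStar W hmod hp2 hpM hN' hA h4 hm4 hsq hgcd' hneg hsplit, pow_zero, mul_one]
  linear_combination -(χ₄_natCast_mul_self hp2)

/-- **THE POTENTIALLY MULTIPLICATIVE ROW, even habitat discriminant, ANY LEVEL: `w(E)·w(E^{(d)}) = −(D'/p)·W_p(E^{(p*)})`**, modulo the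
Modularity Theorem only (minimal model `ord_p c₄ = 2`, `ord_p Δ > 6`; `E^{(p*)}` multiplicative at `p`, `N_{E'} = M·p`, the `k = 1` case):
the sign flips with `(D'/p)`. [cite: MurtyMurty1997, Ch. 6 §1] [cite: Rohrlich1993Compositio, Prop. 2(ii),(iii)] [cite: KellockDokchitser2023, Rem. 2.2] -/
theorem rootNumber_mul_rootNumber_ramifiedTwist_even_of_potMult_anyLevel (W : WeierstrassCurve ℚ) [W.IsElliptic]
    (hmod : exists_isNewformOf) (hp5 : 5 ≤ p) {M : ℕ} (hN : W.conductorNorm ℤ = M * p ^ 2) (hpM : ¬ p ∣ M) {a : ℕ}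
    (hΔ : addVal ℤ_[p] (((W.baseChange ℚ_[p]).minimal ℤ_[p]).integralModel ℤ_[p]).Δ = a) (ha : 6 < a)
    (hc₄ : addVal ℤ_[p] (((W.baseChange ℚ_[p]).minimal ℤ_[p]).integralModel ℤ_[p]).c₄ = 2)
    {D' : ℤ} (h4 : 4 ∣ D') (hm4 : D' / 4 % 4 = 2 ∨ D' / 4 % 4 = 3) (hsq : Squarefree (D' / 4))
    (hgcd : Int.gcd D' (W.conductorNorm ℤ) = 1) (hneg : (-1 : ℤ) ^ (p / 2) * p * D' < 0)
    (hsplit : ∀ q ∈ M.primeFactors, q ≠ 2 → J((-1 : ℤ) ^ (p / 2) * p * D' | q) = 1) :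
    W.rootNumber * (W.quadraticTwist (((-1 : ℤ) ^ (p / 2) * p * D' : ℤ) : ℚ)).rootNumber =
      -legendreSym p D' * ((W.quadraticTwist (((-1 : ℤ) ^ (p / 2) * p : ℤ) : ℚ)).baseChange ℚ_[p]).localRootNumber ℤ_[p] := by
  have hp : p.Prime := Fact.out
  have hp2 : p ≠ 2 := by omega
  have hdZ0 : ((-1 : ℤ) ^ (p / 2) * p : ℤ) ≠ 0 :=
    mul_ne_zero (pow_ne_zero _ (by norm_num)) (by exact_mod_cast hp.ne_zero)
  have hd0 : (((((-1 : ℤ) ^ (p / 2) * p : ℤ)) : ℚ)) ≠ 0 := by exact_mod_cast hdZ0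
  haveI hE' : (W.quadraticTwist (((-1 : ℤ) ^ (p / 2) * p : ℤ) : ℚ)).IsElliptic := W.isElliptic_quadraticTwist hd0
  set w' := ((W.quadraticTwist (((-1 : ℤ) ^ (p / 2) * p : ℤ) : ℚ)).baseChange ℚ_[p]).localRootNumber ℤ_[p] with hw'
  have hA : W.rootNumber * (W.quadraticTwist (((-1 : ℤ) ^ (p / 2) * p : ℤ) : ℚ)).rootNumber =
      legendreSym p M * (ZMod.χ₄ p * w') := by
    rw [rootNumber_mul_rootNumber_pStarTwist_of_potMult_anyLevel W hmod hp5 hN hpM hΔ ha hc₄, mul_assoc]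
  obtain ⟨-, hmult, -⟩ := hasMultiplicativeReduction_pStarTwist_padic_of_potMult W hp5 hΔ ha hc₄
  have hN' : (W.quadraticTwist (((-1 : ℤ) ^ (p / 2) * p : ℤ) : ℚ)).conductorNorm ℤ = M * p ^ 1 := by
    rw [conductorNorm_pStarTwist_eq_mul_of_mult W hp5 hN hpM hmult, pow_one]
  have hgcd' : Int.gcd D' (M * p ^ 1 : ℕ) = 1 := by
    have h1 := Int.isCoprime_iff_gcd_eq_one.mpr hgcd
    rw [hN] at h1
    rw [← Int.isCoprime_iff_gcd_eq_one]
    push_cast at h1 ⊢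
    rw [sq, ← mul_assoc] at h1
    rw [pow_one]
    exact h1.of_mul_right_left
  rw [rootNumber_mul_rootNumber_ramifiedTwist_of_four_dvd_of_pStar W hmod hp2 hpM hN' hA h4 hm4 hsq hgcd' hneg hsplit, pow_one,
    ← jacobiSym.legendreSym.to_jacobiSym]
  linear_combination (-(legendreSym p D') * w') * χ₄_natCast_mul_self hp2

/-! ## §3 Field forms, even `d_{K′}`, any level -/

omit [Fact p.Prime] in
/-- `M ≠ 0` when `N_E = M·p²`. [folklore] -/
private theorem cofactor_ne_zero' (W : WeierstrassCurve ℚ) [W.IsElliptic] {M : ℕ} (hN : W.conductorNorm ℤ = M * p ^ 2) : M ≠ 0 :=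
  fun h ↦ (W.conductorNorm_pos_holds).ne' (by rw [hN, h, zero_mul])

/-- **FIELD FORM, EVEN `d_{K′}`, ANY LEVEL — supercuspidal half, all six types** (`a ∈ {2,3,4,8,9,10}`, `e ∤ p − 1 ⟹ +1`). `K′` imaginary
quadratic, `4 ∣ d_{K′}`, `p ∣ d_{K′}`, every prime of `M` split in `K′`. Conditional on {hmod, F1 at `p`}; BSD is not proved by this.
[cite: Rohrlich1993Compositio, Prop. 2(iv)] [cite: KellockDokchitser2023, Rem. 2.2] -/
theorem rootNumber_mul_rootNumber_twist_discr_even_anyLevel_eq_one_of_not_dvd (W : WeierstrassCurve ℚ) [W.IsElliptic]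
    (hmod : exists_isNewformOf) (hF1 : W.atkinLehnerEigenvalueAt_eq_localRootNumberAt)
    (hF1' : (W.quadraticTwist (((-1 : ℤ) ^ (p / 2) * p : ℤ) : ℚ)).atkinLehnerEigenvalueAt_eq_localRootNumberAt)
    (hp5 : 5 ≤ p) {M : ℕ} (hN : W.conductorNorm ℤ = M * p ^ 2) (hpM : ¬ p ∣ M) {a : ℕ}
    (hΔ : addVal ℤ_[p] (((W.baseChange ℚ_[p]).minimal ℤ_[p]).integralModel ℤ_[p]).Δ = a)
    (ha : a = 2 ∨ a = 3 ∨ a = 4 ∨ a = 8 ∨ a = 9 ∨ a = 10)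
    (hc₄ : addVal ℤ_[p] (((W.baseChange ℚ_[p]).minimal ℤ_[p]).integralModel ℤ_[p]).c₄ ≠ 0)
    (hj : ¬ 3 * addVal ℤ_[p] (((W.baseChange ℚ_[p]).minimal ℤ_[p]).integralModel ℤ_[p]).c₄ <
      addVal ℤ_[p] (((W.baseChange ℚ_[p]).minimal ℤ_[p]).integralModel ℤ_[p]).Δ)
    (K : Type) [Field K] [NumberField K] (hK : IsImaginaryQuadratic K) (h4K : 4 ∣ NumberField.discr K)
    (hpd : (p : ℤ) ∣ NumberField.discr K)
    (hodd : ∀ q ∈ M.primeFactors, q ≠ 2 → J(NumberField.discr K | q) = 1)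
    (htwo : 2 ∣ M → NumberField.discr K % 8 = 1)
    (hsc : ¬ 12 / Nat.gcd a 12 ∣ p - 1) :
    W.rootNumber * (W.quadraticTwist (NumberField.discr K : ℚ)).rootNumber = 1 := by
  obtain ⟨D', hd, h4, hm4, hsq, hgcd, hneg⟩ :=
    ramifiedHabitat_data_of_discr_of_four_dvd (by omega) (cofactor_ne_zero' W hN) K hK h4K hpd hodd htwo
  rw [hd] at hodd ⊢
  rw [← hN] at hgcd
  exact rootNumber_mul_rootNumber_ramifiedTwist_even_of_mem_anyLevel_eq_one_of_not_dvd W hmod hF1 hF1' hp5 hN hpM hΔ ha hc₄ hj h4 hm4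
    hsq hgcd hneg hodd hsc

/-- **FIELD FORM, EVEN `d_{K′}`, ANY LEVEL — principal-series half, all six types** (`e ∣ p − 1 ⟹ −1`; potentially good).
Conditional on {hmod, F1 at `p`}; BSD is not proved by this. [cite: Rohrlich1993Compositio, Prop. 2(iv)] [cite: KellockDokchitser2023, Rem. 2.2] -/
theorem rootNumber_mul_rootNumber_twist_discr_even_anyLevel_eq_neg_one_of_dvd (W : WeierstrassCurve ℚ) [W.IsElliptic]
    (hmod : exists_isNewformOf) (hF1 : W.atkinLehnerEigenvalueAt_eq_localRootNumberAt)
    (hF1' : (W.quadraticTwist (((-1 : ℤ) ^ (p / 2) * p : ℤ) : ℚ)).atkinLehnerEigenvalueAt_eq_localRootNumberAt)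
    (hp5 : 5 ≤ p) {M : ℕ} (hN : W.conductorNorm ℤ = M * p ^ 2) (hpM : ¬ p ∣ M) {a : ℕ}
    (hΔ : addVal ℤ_[p] (((W.baseChange ℚ_[p]).minimal ℤ_[p]).integralModel ℤ_[p]).Δ = a)
    (ha : a = 2 ∨ a = 3 ∨ a = 4 ∨ a = 8 ∨ a = 9 ∨ a = 10)
    (hc₄ : addVal ℤ_[p] (((W.baseChange ℚ_[p]).minimal ℤ_[p]).integralModel ℤ_[p]).c₄ ≠ 0)
    (hj : ¬ 3 * addVal ℤ_[p] (((W.baseChange ℚ_[p]).minimal ℤ_[p]).integralModel ℤ_[p]).c₄ <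
      addVal ℤ_[p] (((W.baseChange ℚ_[p]).minimal ℤ_[p]).integralModel ℤ_[p]).Δ)
    (K : Type) [Field K] [NumberField K] (hK : IsImaginaryQuadratic K) (h4K : 4 ∣ NumberField.discr K)
    (hpd : (p : ℤ) ∣ NumberField.discr K)
    (hodd : ∀ q ∈ M.primeFactors, q ≠ 2 → J(NumberField.discr K | q) = 1)
    (htwo : 2 ∣ M → NumberField.discr K % 8 = 1)
    (hps : 12 / Nat.gcd a 12 ∣ p - 1) :
    W.rootNumber * (W.quadraticTwist (NumberField.discr K : ℚ)).rootNumber = -1 := by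
  obtain ⟨D', hd, h4, hm4, hsq, hgcd, hneg⟩ :=
    ramifiedHabitat_data_of_discr_of_four_dvd (by omega) (cofactor_ne_zero' W hN) K hK h4K hpd hodd htwo
  rw [hd] at hodd ⊢
  rw [← hN] at hgcd
  exact rootNumber_mul_rootNumber_ramifiedTwist_even_of_mem_anyLevel_eq_neg_one_of_dvd W hmod hF1 hF1' hp5 hN hpM hΔ ha hc₄ hj h4 hm4
    hsq hgcd hneg hodd hps

/-- **FIELD FORM, EVEN `d_{K′}`, ANY LEVEL, TYPE I₀*: `w(E)·w(E^{(d_{K′})}) = −1`**, unconditional modulo the Modularity Theorem.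
[cite: MurtyMurty1997, Ch. 6 §1] [cite: Rohrlich1993Compositio, Prop. 2(iv)] -/
theorem rootNumber_mul_rootNumber_twist_discr_even_of_six_anyLevel (W : WeierstrassCurve ℚ) [W.IsElliptic] (hmod : exists_isNewformOf)
    (hp5 : 5 ≤ p) {M : ℕ} (hN : W.conductorNorm ℤ = M * p ^ 2) (hpM : ¬ p ∣ M)
    (hΔ : addVal ℤ_[p] (((W.baseChange ℚ_[p]).minimal ℤ_[p]).integralModel ℤ_[p]).Δ = (6 : ℕ))
    (hc₄ : addVal ℤ_[p] (((W.baseChange ℚ_[p]).minimal ℤ_[p]).integralModel ℤ_[p]).c₄ ≠ 0)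
    (hj : ¬ 3 * addVal ℤ_[p] (((W.baseChange ℚ_[p]).minimal ℤ_[p]).integralModel ℤ_[p]).c₄ <
      addVal ℤ_[p] (((W.baseChange ℚ_[p]).minimal ℤ_[p]).integralModel ℤ_[p]).Δ)
    (K : Type) [Field K] [NumberField K] (hK : IsImaginaryQuadratic K) (h4K : 4 ∣ NumberField.discr K)
    (hpd : (p : ℤ) ∣ NumberField.discr K)
    (hodd : ∀ q ∈ M.primeFactors, q ≠ 2 → J(NumberField.discr K | q) = 1)
    (htwo : 2 ∣ M → NumberField.discr K % 8 = 1) :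
    W.rootNumber * (W.quadraticTwist (NumberField.discr K : ℚ)).rootNumber = -1 := by
  obtain ⟨D', hd, h4, hm4, hsq, hgcd, hneg⟩ :=
    ramifiedHabitat_data_of_discr_of_four_dvd (by omega) (cofactor_ne_zero' W hN) K hK h4K hpd hodd htwo
  rw [hd] at hodd ⊢
  rw [← hN] at hgcd
  exact rootNumber_mul_rootNumber_ramifiedTwist_even_of_six_anyLevel W hmod hp5 hN hpM hΔ hc₄ hj h4 hm4 hsq hgcd hneg hodd

end EvenAnyLevel

end Summit.BirchSwinnertonDyer.BirchSwinnertonDyer.Theorems.AdditiveKoly.RamifiedHabitat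

end
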